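import Mathlib

/-!
# Route LiouvilleSarnak — crux `DigitalBilinearLiouville` (stmt-ValiantsHypothesis-14774):
# the operator norm of a bounded-entry matrix from its rectangle sums (delocalisation)

Tool file for `Theorems/LiouvilleSarnakDigitalBilinearLiouvilleRectangles.lean`, which puts the
crux `DigitalBilinearLiouville` (operator norm `o(2^n)` of every balanced digital cut matrix
`M_π(r, c) = λ(N_π(r, c) + 1)` of the Liouville function, tested against ALL complex vectors) into
RECTANGLE-DISCREPANCY currency (sums of `λ` over digital combinatorial rectangles `A ×_π B`).
The content here is the generic real-analysis step, for any real matrix `M` on finite index types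
with `|M_{rc}| ≤ 1` all of whose rectangle sums `Σ_{r ∈ A} Σ_{c ∈ B} M_{rc}` are `≤ R` in absolute
value:

* §1 sign vectors give `|Σ s_r t_c M_{rc}| ≤ 4R` (`s = 1_A - 1_{Aᶜ}`: four rectangles); SMALL
  vectors (`|x_r|, |y_c| ≤ τ`) give `≤ 4 τ² R` (two sign-roundings:
  `|Σ x_r v_r| ≤ τ Σ |v_r| = τ Σ s_r v_r`); the BIG part of a unit vector (`|x_r| > τ`) has
  `ℓ¹`-norm `≤ 1/τ` (`τ |x_r| ≤ x_r²`), and a unit vector has `ℓ¹`-norm `≤ √(dimension)`.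
* §2 DELOCALISATION (`abs_bilin_le`): for unit `x, y` and every `τ > 0`,
  `|xᵀ M y| ≤ 4 τ² R + (√|rows| + √|cols|)/τ` (split `x = x_small + x_big`, `y` likewise:
  small × small by §1, anything × big by `ℓ¹ × ℓ¹`); the homogeneous form `abs_bilin_le_mul` and
  the complex form `norm_sum_mul_mul_sq_le` (real and imaginary parts: a factor `4`).  With
  `R = δ N²` and `τ = t/√N` this reads `|xᵀ M y| ≤ (4 t² δ + 2/t) N` — the finite form of the
  graphon inequality `‖T_W‖_{op} ≤ C ‖W‖_□^{1/3}`: top singular vectors of a bounded kernel are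
  delocalised, so the cut norm controls the operator norm with a polynomial loss.

Honest framing: elementary real analysis, no number theory; the crux `DigitalBilinearLiouville`,
`LiouvilleCutRank` and `AlgebraicSarnak` stay OPEN, and nothing here bears on VP versus VNP.
No definitions.
-/

-- the directory `ValiantsHypothesis/ValiantsHypothesis` repeats the summit name (tree layout)
set_option linter.dupNamespace false

namespace Summit.ValiantsHypothesis.ValiantsHypothesis.Theorems.LiouvilleSarnakDigitalBilinearLiouville.Rectangles

open Finset

variable {ι κ : Type*} [Fintype ι] [Fintype κ] [DecidableEq ι] [DecidableEq κ]

/-! ### §1 Sign vectors, small vectors, big parts -/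

/-- Indicator test vectors pick out a rectangle sum. [folklore] -/
theorem sum_indicator_mul_indicator_mul {S : Type*} [Semiring S] (M : ι → κ → S) (A : Finset ι)
    (B : Finset κ) :
    ∑ r, ∑ c, (if r ∈ A then (1 : S) else 0) * (if c ∈ B then (1 : S) else 0) * M r c =
      ∑ r ∈ A, ∑ c ∈ B, M r c := by
  have hrow : ∀ r, ∑ c, (if r ∈ A then (1 : S) else 0) * (if c ∈ B then (1 : S) else 0) * M r c =
      if r ∈ A then ∑ c ∈ B, M r c else 0 := by
    intro r
    by_cases hr : r ∈ A
    · simp only [hr, if_true, one_mul, ite_mul, zero_mul]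
      rw [Finset.sum_ite_mem, Finset.univ_inter]
    · simp [hr]
  simp_rw [hrow]
  rw [Finset.sum_ite_mem, Finset.univ_inter]

/-- **Sign vectors versus rectangles.**  If every rectangle sum of `M` is `≤ R` in absolute value,
then `|Σ_{r,c} s_r t_c M_{rc}| ≤ 4R` for all sign vectors `s = 1_A - 1_{Aᶜ}`, `t = 1_B - 1_{Bᶜ}`
(four rectangles). [folklore] -/
theorem abs_sum_sign_mul_sign_mul_le (M : ι → κ → ℝ) (R : ℝ)
    (hR : ∀ (A : Finset ι) (B : Finset κ), |∑ r ∈ A, ∑ c ∈ B, M r c| ≤ R)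
    (A : Finset ι) (B : Finset κ) :
    |∑ r, ∑ c, (if r ∈ A then (1 : ℝ) else -1) * (if c ∈ B then (1 : ℝ) else -1) * M r c| ≤
      4 * R := by
  have hexp : ∀ r c, (if r ∈ A then (1 : ℝ) else -1) * (if c ∈ B then (1 : ℝ) else -1) * M r c =
      (if r ∈ A then (1 : ℝ) else 0) * (if c ∈ B then (1 : ℝ) else 0) * M r c -
      (if r ∈ A then (1 : ℝ) else 0) * (if c ∈ Bᶜ then (1 : ℝ) else 0) * M r c -
      (if r ∈ Aᶜ then (1 : ℝ) else 0) * (if c ∈ B then (1 : ℝ) else 0) * M r c +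
      (if r ∈ Aᶜ then (1 : ℝ) else 0) * (if c ∈ Bᶜ then (1 : ℝ) else 0) * M r c := by
    intro r c
    simp only [Finset.mem_compl]
    split_ifs <;> ring
  simp_rw [hexp, Finset.sum_add_distrib, Finset.sum_sub_distrib, sum_indicator_mul_indicator_mul]
  have h1 := hR A B
  have h2 := hR A Bᶜ
  have h3 := hR Aᶜ B
  have h4 := hR Aᶜ Bᶜ
  calc |∑ r ∈ A, ∑ c ∈ B, M r c - ∑ r ∈ A, ∑ c ∈ Bᶜ, M r c - ∑ r ∈ Aᶜ, ∑ c ∈ B, M r c +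
          ∑ r ∈ Aᶜ, ∑ c ∈ Bᶜ, M r c|
      ≤ |∑ r ∈ A, ∑ c ∈ B, M r c - ∑ r ∈ A, ∑ c ∈ Bᶜ, M r c - ∑ r ∈ Aᶜ, ∑ c ∈ B, M r c| +
          |∑ r ∈ Aᶜ, ∑ c ∈ Bᶜ, M r c| := abs_add_le _ _
    _ ≤ |∑ r ∈ A, ∑ c ∈ B, M r c - ∑ r ∈ A, ∑ c ∈ Bᶜ, M r c| + |∑ r ∈ Aᶜ, ∑ c ∈ B, M r c| +
          |∑ r ∈ Aᶜ, ∑ c ∈ Bᶜ, M r c| := by gcongr; exact abs_sub _ _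
    _ ≤ |∑ r ∈ A, ∑ c ∈ B, M r c| + |∑ r ∈ A, ∑ c ∈ Bᶜ, M r c| + |∑ r ∈ Aᶜ, ∑ c ∈ B, M r c| +
          |∑ r ∈ Aᶜ, ∑ c ∈ Bᶜ, M r c| := by gcongr; exact abs_sub _ _
    _ ≤ 4 * R := by linarith

/-- **Sign rounding.**  If `|x_r| ≤ τ` for all `r`, then `|Σ_r x_r v_r| ≤ τ Σ_r s_r v_r` for the sign
vector `s_r = 1` if `0 ≤ v_r`, `-1` otherwise. [folklore] -/
theorem abs_sum_mul_le_mul_sum_sign_mul (τ : ℝ) (x v : ι → ℝ) (hx : ∀ r, |x r| ≤ τ) :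
    |∑ r, x r * v r| ≤
      τ * ∑ r, (if r ∈ Finset.univ.filter (fun r => 0 ≤ v r) then (1 : ℝ) else -1) * v r := by
  have hsv : ∀ r, |v r| = (if r ∈ Finset.univ.filter (fun r => 0 ≤ v r) then (1 : ℝ) else -1) *
      v r := by
    intro r
    by_cases h : 0 ≤ v r
    · have hr : r ∈ Finset.univ.filter (fun r => 0 ≤ v r) := by simp [h]
      rw [if_pos hr, one_mul, abs_of_nonneg h]
    · have hr : r ∉ Finset.univ.filter (fun r => 0 ≤ v r) := by simp [h]
      rw [if_neg hr, abs_of_neg (not_le.mp h)]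
      ring
  calc |∑ r, x r * v r| ≤ ∑ r, |x r * v r| := Finset.abs_sum_le_sum_abs _ _
    _ = ∑ r, |x r| * |v r| := by simp_rw [abs_mul]
    _ ≤ ∑ r, τ * |v r| :=
        Finset.sum_le_sum fun r _ => mul_le_mul_of_nonneg_right (hx r) (abs_nonneg _)
    _ = τ * ∑ r, (if r ∈ Finset.univ.filter (fun r => 0 ≤ v r) then (1 : ℝ) else -1) * v r := by
        rw [Finset.mul_sum]
        simp_rw [hsv]

/-- **Small vectors.**  If every rectangle sum of `M` is `≤ R` in absolute value and
`|x_r|, |y_c| ≤ τ`, then `|Σ_{r,c} x_r y_c M_{rc}| ≤ 4 τ² R`: round `x` to the signs of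
`v_r = Σ_c y_c M_{rc}`, then `y` to the signs of `ω_c = Σ_r s_r M_{rc}`, and use the sign-vector
bound. [folklore] -/
theorem abs_bilin_le_of_small (M : ι → κ → ℝ) (R : ℝ)
    (hR : ∀ (A : Finset ι) (B : Finset κ), |∑ r ∈ A, ∑ c ∈ B, M r c| ≤ R)
    (τ : ℝ) (hτ : 0 ≤ τ) (x : ι → ℝ) (y : κ → ℝ) (hx : ∀ r, |x r| ≤ τ) (hy : ∀ c, |y c| ≤ τ) :
    |∑ r, ∑ c, x r * y c * M r c| ≤ τ ^ 2 * (4 * R) := by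
  -- round `x`
  set v : ι → ℝ := fun r => ∑ c, y c * M r c with hv
  set A : Finset ι := Finset.univ.filter (fun r => 0 ≤ v r) with hA
  set s : ι → ℝ := fun r => if r ∈ A then (1 : ℝ) else -1 with hs
  have h1 : ∑ r, ∑ c, x r * y c * M r c = ∑ r, x r * v r := by
    refine Finset.sum_congr rfl fun r _ => ?_
    rw [hv, Finset.mul_sum]
    exact Finset.sum_congr rfl fun c _ => by ring
  have h2 : |∑ r, x r * v r| ≤ τ * ∑ r, s r * v r := abs_sum_mul_le_mul_sum_sign_mul τ x v hx
  -- round `y`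
  set ω : κ → ℝ := fun c => ∑ r, s r * M r c with hω
  set B : Finset κ := Finset.univ.filter (fun c => 0 ≤ ω c) with hB
  set t : κ → ℝ := fun c => if c ∈ B then (1 : ℝ) else -1 with ht
  have h3 : ∑ r, s r * v r = ∑ c, y c * ω c := by
    simp only [hv, hω, Finset.mul_sum]
    rw [Finset.sum_comm]
    exact Finset.sum_congr rfl fun c _ => Finset.sum_congr rfl fun r _ => by ring
  have h4 : |∑ c, y c * ω c| ≤ τ * ∑ c, t c * ω c := abs_sum_mul_le_mul_sum_sign_mul τ y ω hy
  have h5 : ∑ c, t c * ω c = ∑ r, ∑ c, s r * t c * M r c := by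
    simp only [hω, Finset.mul_sum]
    rw [Finset.sum_comm]
    exact Finset.sum_congr rfl fun c _ => Finset.sum_congr rfl fun r _ => by ring
  have h6 : |∑ r, ∑ c, s r * t c * M r c| ≤ 4 * R := abs_sum_sign_mul_sign_mul_le M R hR A B
  -- chain
  have h7 : ∑ c, t c * ω c ≤ 4 * R := (le_abs_self _).trans (h5 ▸ h6)
  have h8 : ∑ r, s r * v r ≤ τ * (4 * R) := by
    rw [h3]
    exact (le_abs_self _).trans (h4.trans (mul_le_mul_of_nonneg_left h7 hτ))
  rw [h1]
  calc |∑ r, x r * v r| ≤ τ * ∑ r, s r * v r := h2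
    _ ≤ τ * (τ * (4 * R)) := mul_le_mul_of_nonneg_left h8 hτ
    _ = τ ^ 2 * (4 * R) := by ring

omit [DecidableEq ι] [DecidableEq κ] in
/-- **`ℓ¹ × ℓ¹` bound**: `|Σ_{r,c} f_r g_c M_{rc}| ≤ ‖f‖₁ ‖g‖₁` when `|M_{rc}| ≤ 1`. [folklore] -/
theorem abs_bilin_le_sum_abs_mul_sum_abs (M : ι → κ → ℝ) (hM : ∀ r c, |M r c| ≤ 1)
    (f : ι → ℝ) (g : κ → ℝ) :
    |∑ r, ∑ c, f r * g c * M r c| ≤ (∑ r, |f r|) * ∑ c, |g c| := by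
  calc |∑ r, ∑ c, f r * g c * M r c| ≤ ∑ r, |∑ c, f r * g c * M r c| :=
        Finset.abs_sum_le_sum_abs _ _
    _ ≤ ∑ r, ∑ c, |f r * g c * M r c| :=
        Finset.sum_le_sum fun r _ => Finset.abs_sum_le_sum_abs _ _
    _ ≤ ∑ r, ∑ c, |f r| * |g c| := by
        refine Finset.sum_le_sum fun r _ => Finset.sum_le_sum fun c _ => ?_
        rw [abs_mul, abs_mul]
        exact mul_le_of_le_one_right (by positivity) (hM r c)
    _ = (∑ r, |f r|) * ∑ c, |g c| := by rw [Finset.sum_mul_sum]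

omit [Fintype κ] [DecidableEq ι] [DecidableEq κ] in
/-- A vector with `Σ z_r² ≤ 1` has `ℓ¹`-norm `≤ √(dimension)` (Cauchy–Schwarz). [folklore] -/
theorem sum_abs_le_sqrt_card (z : ι → ℝ) (hz : ∑ r, z r ^ 2 ≤ 1) :
    ∑ r, |z r| ≤ Real.sqrt (Fintype.card ι) := by
  apply Real.le_sqrt_of_sq_le
  have hcs := Finset.sum_mul_sq_le_sq_mul_sq Finset.univ (fun r => |z r|) (fun _ => (1 : ℝ))
  simp only [mul_one, one_pow, Finset.sum_const, Finset.card_univ, nsmul_eq_mul, sq_abs] at hcs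
  calc (∑ r, |z r|) ^ 2 ≤ (∑ r, z r ^ 2) * (Fintype.card ι) := hcs
    _ ≤ 1 * (Fintype.card ι) := by gcongr
    _ = Fintype.card ι := one_mul _

omit [Fintype κ] [DecidableEq ι] [DecidableEq κ] in
/-- The BIG part `x · 1[|x| > τ]` of a vector with `Σ x_r² ≤ 1` has `ℓ¹`-norm `≤ 1/τ`
(`τ |x_r| ≤ x_r²` on the big coordinates). [folklore] -/
theorem sum_abs_big_le (x : ι → ℝ) (hx : ∑ r, x r ^ 2 ≤ 1) (τ : ℝ) (hτ : 0 < τ) :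
    ∑ r, |(if τ < |x r| then x r else 0)| ≤ 1 / τ := by
  rw [le_div_iff₀ hτ, Finset.sum_mul]
  calc ∑ r, |(if τ < |x r| then x r else 0)| * τ ≤ ∑ r, x r ^ 2 :=
        Finset.sum_le_sum fun r _ => by
          split_ifs with h
          · rw [sq, ← abs_mul_abs_self]
            exact mul_le_mul_of_nonneg_left h.le (abs_nonneg _)
          · rw [abs_zero, zero_mul]
            exact sq_nonneg _
    _ ≤ 1 := hx

/-! ### §2 Delocalisation: operator norm from rectangle sums -/

/-- **Delocalisation (unit vectors).**  If `|M_{rc}| ≤ 1`, every rectangle sum of `M` is `≤ R`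
in absolute value, and `Σ x_r² ≤ 1`, `Σ y_c² ≤ 1`, then for every `τ > 0`
`|Σ_{r,c} x_r y_c M_{rc}| ≤ 4 τ² R + (√|ι| + √|κ|)/τ`: split each vector into its small
(`|·| ≤ τ`) and big parts; small × small by the sign-vector bound, anything × big by
`ℓ¹ × ℓ¹`. [folklore] -/
theorem abs_bilin_le (M : ι → κ → ℝ) (hM : ∀ r c, |M r c| ≤ 1) (R : ℝ)
    (hR : ∀ (A : Finset ι) (B : Finset κ), |∑ r ∈ A, ∑ c ∈ B, M r c| ≤ R)
    (τ : ℝ) (hτ : 0 < τ) (x : ι → ℝ) (y : κ → ℝ)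
    (hx : ∑ r, x r ^ 2 ≤ 1) (hy : ∑ c, y c ^ 2 ≤ 1) :
    |∑ r, ∑ c, x r * y c * M r c| ≤
      τ ^ 2 * (4 * R) + (Real.sqrt (Fintype.card ι) + Real.sqrt (Fintype.card κ)) / τ := by
  set xs : ι → ℝ := fun r => if τ < |x r| then 0 else x r with hxs
  set xb : ι → ℝ := fun r => if τ < |x r| then x r else 0 with hxb
  set ys : κ → ℝ := fun c => if τ < |y c| then 0 else y c with hys
  set yb : κ → ℝ := fun c => if τ < |y c| then y c else 0 with hyb
  have hxsplit : ∀ r, x r = xs r + xb r := by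
    intro r; simp only [hxs, hxb]; split_ifs <;> simp
  have hysplit : ∀ c, y c = ys c + yb c := by
    intro c; simp only [hys, hyb]; split_ifs <;> simp
  have hxs_small : ∀ r, |xs r| ≤ τ := by
    intro r; simp only [hxs]
    split_ifs with h
    · rw [abs_zero]; exact hτ.le
    · exact not_lt.mp h
  have hys_small : ∀ c, |ys c| ≤ τ := by
    intro c; simp only [hys]
    split_ifs with h
    · rw [abs_zero]; exact hτ.le
    · exact not_lt.mp h
  have hxs_sq : ∑ r, xs r ^ 2 ≤ 1 := by
    refine le_trans (Finset.sum_le_sum fun r _ => ?_) hx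
    simp only [hxs]
    split_ifs
    · rw [zero_pow two_ne_zero]; exact sq_nonneg _
    · exact le_rfl
  have hsplit : ∑ r, ∑ c, x r * y c * M r c =
      (∑ r, ∑ c, xs r * ys c * M r c) + (∑ r, ∑ c, xs r * yb c * M r c) +
        ∑ r, ∑ c, xb r * y c * M r c := by
    have hterm : ∀ r c, x r * y c * M r c =
        xs r * ys c * M r c + xs r * yb c * M r c + xb r * y c * M r c := by
      intro r c
      have h1 := hxsplit r
      have h2 := hysplit c
      rw [h1, h2]
      ring
    simp_rw [hterm, Finset.sum_add_distrib]
  have b1 : |∑ r, ∑ c, xs r * ys c * M r c| ≤ τ ^ 2 * (4 * R) :=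
    abs_bilin_le_of_small M R hR τ hτ.le xs ys hxs_small hys_small
  have b2 : |∑ r, ∑ c, xs r * yb c * M r c| ≤ Real.sqrt (Fintype.card ι) * (1 / τ) :=
    (abs_bilin_le_sum_abs_mul_sum_abs M hM xs yb).trans
      (mul_le_mul (sum_abs_le_sqrt_card xs hxs_sq) (sum_abs_big_le y hy τ hτ)
        (Finset.sum_nonneg fun c _ => abs_nonneg _) (Real.sqrt_nonneg _))
  have b3 : |∑ r, ∑ c, xb r * y c * M r c| ≤ (1 / τ) * Real.sqrt (Fintype.card κ) :=
    (abs_bilin_le_sum_abs_mul_sum_abs M hM xb y).trans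
      (mul_le_mul (sum_abs_big_le x hx τ hτ) (sum_abs_le_sqrt_card y hy)
        (Finset.sum_nonneg fun c _ => abs_nonneg _) (by positivity))
  rw [hsplit]
  calc |(∑ r, ∑ c, xs r * ys c * M r c) + (∑ r, ∑ c, xs r * yb c * M r c) +
          ∑ r, ∑ c, xb r * y c * M r c|
      ≤ |(∑ r, ∑ c, xs r * ys c * M r c) + (∑ r, ∑ c, xs r * yb c * M r c)| +
          |∑ r, ∑ c, xb r * y c * M r c| := abs_add_le _ _
    _ ≤ |∑ r, ∑ c, xs r * ys c * M r c| + |∑ r, ∑ c, xs r * yb c * M r c| +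
          |∑ r, ∑ c, xb r * y c * M r c| := by gcongr; exact abs_add_le _ _
    _ ≤ τ ^ 2 * (4 * R) + Real.sqrt (Fintype.card ι) * (1 / τ) +
          (1 / τ) * Real.sqrt (Fintype.card κ) := by gcongr
    _ = τ ^ 2 * (4 * R) + (Real.sqrt (Fintype.card ι) + Real.sqrt (Fintype.card κ)) / τ := by
        ring

/-- **Delocalisation (homogeneous form).**  For all real `x, y`:
`|Σ x_r y_c M_{rc}| ≤ (4 τ² R + (√|ι| + √|κ|)/τ) · √(Σ x_r²) · √(Σ y_c²)`. [folklore] -/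
theorem abs_bilin_le_mul (M : ι → κ → ℝ) (hM : ∀ r c, |M r c| ≤ 1) (R : ℝ)
    (hR : ∀ (A : Finset ι) (B : Finset κ), |∑ r ∈ A, ∑ c ∈ B, M r c| ≤ R)
    (τ : ℝ) (hτ : 0 < τ) (x : ι → ℝ) (y : κ → ℝ) :
    |∑ r, ∑ c, x r * y c * M r c| ≤
      (τ ^ 2 * (4 * R) + (Real.sqrt (Fintype.card ι) + Real.sqrt (Fintype.card κ)) / τ) *
        Real.sqrt (∑ r, x r ^ 2) * Real.sqrt (∑ c, y c ^ 2) := by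
  set X : ℝ := Real.sqrt (∑ r, x r ^ 2) with hX
  set Y : ℝ := Real.sqrt (∑ c, y c ^ 2) with hY
  have hx0 : 0 ≤ ∑ r, x r ^ 2 := Finset.sum_nonneg fun r _ => sq_nonneg _
  have hy0 : 0 ≤ ∑ c, y c ^ 2 := Finset.sum_nonneg fun c _ => sq_nonneg _
  by_cases hXz : X = 0
  · have hxz : ∀ r, x r = 0 := by
      have h := (Real.sqrt_eq_zero hx0).mp hXz
      intro r
      have := (Finset.sum_eq_zero_iff_of_nonneg (fun r _ => sq_nonneg (x r))).mp h r
        (Finset.mem_univ r)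
      exact (pow_eq_zero_iff two_ne_zero).mp this
    simp [hxz, hXz]
  by_cases hYz : Y = 0
  · have hyz : ∀ c, y c = 0 := by
      have h := (Real.sqrt_eq_zero hy0).mp hYz
      intro c
      have := (Finset.sum_eq_zero_iff_of_nonneg (fun c _ => sq_nonneg (y c))).mp h c
        (Finset.mem_univ c)
      exact (pow_eq_zero_iff two_ne_zero).mp this
    simp [hyz, hYz]
  have hXpos : 0 < X := lt_of_le_of_ne (Real.sqrt_nonneg _) (Ne.symm hXz)
  have hYpos : 0 < Y := lt_of_le_of_ne (Real.sqrt_nonneg _) (Ne.symm hYz)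
  have hx1 : ∑ r, (x r / X) ^ 2 ≤ 1 := by
    have h : ∑ r, (x r / X) ^ 2 = (∑ r, x r ^ 2) / X ^ 2 := by
      simp_rw [div_pow]
      rw [Finset.sum_div]
    rw [h, hX, Real.sq_sqrt hx0]
    exact div_self_le_one _
  have hy1 : ∑ c, (y c / Y) ^ 2 ≤ 1 := by
    have h : ∑ c, (y c / Y) ^ 2 = (∑ c, y c ^ 2) / Y ^ 2 := by
      simp_rw [div_pow]
      rw [Finset.sum_div]
    rw [h, hY, Real.sq_sqrt hy0]
    exact div_self_le_one _
  have key := abs_bilin_le M hM R hR τ hτ (fun r => x r / X) (fun c => y c / Y) hx1 hy1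
  have hscale : ∑ r, ∑ c, x r / X * (y c / Y) * M r c =
      (∑ r, ∑ c, x r * y c * M r c) / (X * Y) := by
    rw [Finset.sum_div]
    refine Finset.sum_congr rfl fun r _ => ?_
    rw [Finset.sum_div]
    exact Finset.sum_congr rfl fun c _ => by ring
  rw [hscale, abs_div, abs_of_pos (mul_pos hXpos hYpos), div_le_iff₀ (mul_pos hXpos hYpos)]
    at key
  calc |∑ r, ∑ c, x r * y c * M r c|
      ≤ (τ ^ 2 * (4 * R) + (Real.sqrt (Fintype.card ι) + Real.sqrt (Fintype.card κ)) / τ) *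
          (X * Y) := key
    _ = _ := by ring

/-- **Delocalisation (complex bilinear form).**  For complex `u, w` and a real matrix with
`|M_{rc}| ≤ 1` all of whose rectangle sums are `≤ R` in absolute value, for every `τ > 0`:
`‖Σ u_r w_c M_{rc}‖² ≤ 4 (4 τ² R + (√|ι| + √|κ|)/τ)² (Σ ‖u_r‖²) (Σ ‖w_c‖²)`
(real and imaginary parts: four real bilinear forms). [folklore] -/
theorem norm_sum_mul_mul_sq_le (M : ι → κ → ℝ) (hM : ∀ r c, |M r c| ≤ 1) (R : ℝ)
    (hR : ∀ (A : Finset ι) (B : Finset κ), |∑ r ∈ A, ∑ c ∈ B, M r c| ≤ R)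
    (τ : ℝ) (hτ : 0 < τ) (u : ι → ℂ) (w : κ → ℂ) :
    ‖∑ r, ∑ c, u r * w c * (M r c : ℂ)‖ ^ 2 ≤
      4 * (τ ^ 2 * (4 * R) + (Real.sqrt (Fintype.card ι) + Real.sqrt (Fintype.card κ)) / τ) ^ 2 *
        (∑ r, ‖u r‖ ^ 2) * (∑ c, ‖w c‖ ^ 2) := by
  set K : ℝ := τ ^ 2 * (4 * R) + (Real.sqrt (Fintype.card ι) + Real.sqrt (Fintype.card κ)) / τ
    with hK
  set a : ι → ℝ := fun r => (u r).re with ha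
  set b : ι → ℝ := fun r => (u r).im with hb
  set c' : κ → ℝ := fun c => (w c).re with hc'
  set d : κ → ℝ := fun c => (w c).im with hd
  set S : ℂ := ∑ r, ∑ c, u r * w c * (M r c : ℂ) with hS
  have hre : S.re = (∑ r, ∑ c, a r * c' c * M r c) - ∑ r, ∑ c, b r * d c * M r c := by
    rw [hS, Complex.re_sum, ← Finset.sum_sub_distrib]
    refine Finset.sum_congr rfl fun r _ => ?_
    rw [Complex.re_sum, ← Finset.sum_sub_distrib]
    refine Finset.sum_congr rfl fun c _ => ?_
    simp only [Complex.mul_re, Complex.mul_im, Complex.ofReal_re, Complex.ofReal_im, ha, hb,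
      hc', hd]
    ring
  have him : S.im = (∑ r, ∑ c, a r * d c * M r c) + ∑ r, ∑ c, b r * c' c * M r c := by
    rw [hS, Complex.im_sum, ← Finset.sum_add_distrib]
    refine Finset.sum_congr rfl fun r _ => ?_
    rw [Complex.im_sum, ← Finset.sum_add_distrib]
    refine Finset.sum_congr rfl fun c _ => ?_
    simp only [Complex.mul_re, Complex.mul_im, Complex.ofReal_re, Complex.ofReal_im, ha, hb,
      hc', hd]
    ring
  -- norms of the real and imaginary parts
  set Xa : ℝ := Real.sqrt (∑ r, a r ^ 2)
  set Xb : ℝ := Real.sqrt (∑ r, b r ^ 2)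
  set Yc : ℝ := Real.sqrt (∑ c, c' c ^ 2)
  set Yd : ℝ := Real.sqrt (∑ c, d c ^ 2)
  have h1 := abs_bilin_le_mul M hM R hR τ hτ a c'
  have h2 := abs_bilin_le_mul M hM R hR τ hτ b d
  have h3 := abs_bilin_le_mul M hM R hR τ hτ a d
  have h4 := abs_bilin_le_mul M hM R hR τ hτ b c'
  have hSle : ‖S‖ ≤ K * ((Xa + Xb) * (Yc + Yd)) := by
    calc ‖S‖ ≤ |S.re| + |S.im| := Complex.norm_le_abs_re_add_abs_im S
      _ ≤ (|∑ r, ∑ c, a r * c' c * M r c| + |∑ r, ∑ c, b r * d c * M r c|) +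
            (|∑ r, ∑ c, a r * d c * M r c| + |∑ r, ∑ c, b r * c' c * M r c|) := by
          rw [hre, him]
          exact add_le_add (abs_sub _ _) (abs_add_le _ _)
      _ ≤ (K * Xa * Yc + K * Xb * Yd) + (K * Xa * Yd + K * Xb * Yc) := by
          gcongr
      _ = K * ((Xa + Xb) * (Yc + Yd)) := by ring
  have hu : Xa ^ 2 + Xb ^ 2 = ∑ r, ‖u r‖ ^ 2 := by
    rw [Real.sq_sqrt (Finset.sum_nonneg fun r _ => sq_nonneg _),
      Real.sq_sqrt (Finset.sum_nonneg fun r _ => sq_nonneg _), ← Finset.sum_add_distrib]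
    refine Finset.sum_congr rfl fun r _ => ?_
    rw [Complex.sq_norm, Complex.normSq_apply, ha, hb]
    ring
  have hw : Yc ^ 2 + Yd ^ 2 = ∑ c, ‖w c‖ ^ 2 := by
    rw [Real.sq_sqrt (Finset.sum_nonneg fun c _ => sq_nonneg _),
      Real.sq_sqrt (Finset.sum_nonneg fun c _ => sq_nonneg _), ← Finset.sum_add_distrib]
    refine Finset.sum_congr rfl fun c _ => ?_
    rw [Complex.sq_norm, Complex.normSq_apply, hc', hd]
    ring
  have hXa : 0 ≤ Xa := Real.sqrt_nonneg _
  have hXb : 0 ≤ Xb := Real.sqrt_nonneg _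
  have hYc : 0 ≤ Yc := Real.sqrt_nonneg _
  have hYd : 0 ≤ Yd := Real.sqrt_nonneg _
  have hsq := pow_le_pow_left₀ (norm_nonneg S) hSle 2
  rw [← hu, ← hw]
  calc ‖S‖ ^ 2 ≤ (K * ((Xa + Xb) * (Yc + Yd))) ^ 2 := hsq
    _ = K ^ 2 * ((Xa + Xb) ^ 2 * (Yc + Yd) ^ 2) := by ring
    _ ≤ K ^ 2 * ((2 * (Xa ^ 2 + Xb ^ 2)) * (2 * (Yc ^ 2 + Yd ^ 2))) := by
        apply mul_le_mul_of_nonneg_left _ (sq_nonneg K)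
        apply mul_le_mul _ _ (sq_nonneg _) (by positivity)
        · nlinarith [sq_nonneg (Xa - Xb)]
        · nlinarith [sq_nonneg (Yc - Yd)]
    _ = 4 * K ^ 2 * (Xa ^ 2 + Xb ^ 2) * (Yc ^ 2 + Yd ^ 2) := by ring

end Summit.ValiantsHypothesis.ValiantsHypothesis.Theorems.LiouvilleSarnakDigitalBilinearLiouville.Rectangles
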